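import Literature.Computability.Complexity.IKWExtTable
import Literature.Computability.Complexity.IKWTableGenerator
import Literature.Computability.Complexity.CodeFPBudgets
import Literature.Computability.Complexity.CodeFPLists
import Literature.Computability.Complexity.CodeFPFinite
import HarnessLib

/-!
# The IKW generator as a machine, II: the generator on lists, its agreement with `IKWGen.genPad`, and its
# computation on codes (`F ∈ FP`) — IKW 2002, Thm. 11, machine half

Topic `Computability/Complexity`. Sequel of `IKWExtTable.lean` (part I: the low-degree-extension bits read
off a table, brick `IKWGenM.coreTF`) and `IKWTableGenerator.lean` (the explicit generator `IKWGen.genPad`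
and its pseudorandomness). Two layers, in the style of `HiraharaMachineEval/EvalEq/EvalFP.lean`:

**(A) The generator on lists and its agreement with the specification** — every ingredient an explicit
function of the truth table `r`, the output length `n`, the seed `sl` and natural-number parameters:

* `parityT`, `parityFin_eq_parityT`, `sum_bz_eq` (parities of listed bits and sums in `𝔽₂`);
* `cikkPosT q ℓ I k = (Σ_{c<ℓ, bit_c(I)} k^c mod q) + q·k` — the position of coordinate `k` of block `I` of the
  polynomial design `cikkDesign` (`MetaComplexity/NWGenerator.lean`), **`cikkDesign_val`**;
* `g1T N m r w` — the mildly hard bit, read off the table by `coreTF` (`g1T_ofFn`: `= MildHardFn.mildFn f₀ η hm w'`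
  on honest inputs with fuel `N ≥ 2^{lenOf η}`);
* `inpT` (the `I`-th query input of the amplification: design bit ⊕ Hankel parity ⊕ shift bit, cf.
  `HiraharaMachineEval.inpT`), **`inpT_ofFn`** (`= IWAmp.inp (blocks m n) (hidx m n) I (parseSeed u)`);
  `ampT` = parity of the `kk` answers, **`ampT_ofFn`** (`= IKWGen.g2 f₀ n u`);
* `blockT` (the NW block of output `J` read off the seed), `blockT_ofFn`; `mOfT r = log₂ |r|`;
  `genStrT N r n sl` — the output string (all-zero when the seed is too short, as `genPad`), and
  **`genStrT_getD`**: `(genStrT N (truthTable f₀) n (List.ofFn s)).getD i false = IKWGen.genPad f₀ n K s i` for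
  fuel `N ≥ 2^{N₁(m)}`.

**(B) The generator on codes** — `genStrT` is computed by a polynomial-time string function on the code
`⟨r, ⟨1ⁿ, sl⟩⟩` (exactly the input convention of `tableGenerator`, `HardnessVsRandomness.lean`), assembled
in the typed `CodeFP` algebra (`CodeFP.lean`, `CodeFPArith.lean`, `CodeFPBudgets.lean`, `CodeFPLists.lean`,
`CodeFPFinite.lean`), every enumeration running within the master budget `BT = (|r| + n + 2)^60` (in unary,
by `unitsPow`), which is also the fuel of the table brick:

* generic helpers (`bitReadNat`, `getBit`, `codeFP_parityT`, `codeFP_testBit`, `bitsToStr`,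
  `find?_range_eq_some`); the budget and its inequalities (`ST`, `BT`, `…_le_pow`, `le_BT`);
* the parameters on codes (`codeFP_mOfT`, `codeFP_eta` by the bounded search `etaSearchT`, `codeFP_N1`,
  `codeFP_ell`, `codeFP_S2`, `codeFP_kk`, `codeFP_mH`, the primes `q₁, q₂` by trial division `primeBT` /
  `lpgSearchT` / `lpgSearchT_eq`, `codeFP_L2`, `codeFP_seedLen`);
* the design positions by a bounded-state Horner fold (`pvStep`, `polyValFoldT`, `cikkPosCapT`,
  `cikkPosCapT_eq`, `codeFP_cikkPos`);
* the mild bit as a brick atom (`codeFP_g1T`), then `codeFP_inpT`, `codeFP_ampT`, `codeFP_blockT`,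
  `codeFP_genStrT`;
* **`exists_FP_tableGenerator_eq_genPad`**: there is `F ∈ FP` with `tableGenerator F f K n = IKWGen.genPad f n K`
  for all `m, f, K, n` — the machine half of the discrete Theorem 11, consumed with
  `IKWGen.exists_hardness_exponent` by `IKW2002_thm12_2_holds` (`IKWGeneratorsProofs.lean`).

Everything is proved; no facts. Nothing duplicates the tree (searched `cikkPos`, `genStr`, `lpgSearch`,
`tableGenerator_eq`); the private helpers of `HiraharaMachineEvalFP.lean` (`bitRead`, `codeFP_parityT`,
`codeFP_testBit`) and `SumcheckMA.bitsToStr` are re-proved here rather than imported across clusters.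

## References

* R. Impagliazzo, V. Kabanets, A. Wigderson, *In search of an easy witness: exponential time vs.
  probabilistic polynomial time*, JCSS 65 (2002), Thm. 11 ("there is a polynomial-time computable `F`")
  [ImpagliazzoKabanetsWigderson2002].
* N. Nisan, A. Wigderson, *Hardness vs randomness*, JCSS 49 (1994), §2 [NisanWigderson1994].
* S. Hirahara, ECCC TR22-119, proof of Lemma 8.1 (the code `Amp`, the Hankel hitter) [Hirahara2022PartialMCSP].
* M. Carmosino, R. Impagliazzo, V. Kabanets, A. Kolokolova, CCC 2016, §3.1 (the polynomial design)
  [CarmosinoImpagliazzoKabanetsKolokolova2016].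
* S. Arora, B. Barak, *Computational Complexity: A Modern Approach*, CUP 2009, §1.2–1.3, §20.2
  [AroraBarakCC2009].
-/

noncomputable section

namespace Literature.Computability.Complexity

open Finset MetaComplexity IWAmpFn IKWGen

namespace IKWGenM

/-! ## (A) The generator on lists and its agreement with the specification -/

/-! ### Parities and `𝔽₂` -/

/-- Parity of a list of bits. [folklore] -/
def parityT (l : List Bool) : Bool := l.foldl xor false

/-- `parityFin` is the XOR-fold of the listed bits. [folklore] -/
theorem parityFin_eq_parityT : ∀ (M : ℕ) (z : Fin M → Bool), parityFin M z = parityT (List.ofFn z)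
  | 0, _ => rfl
  | M + 1, z => by
    rw [parityFin, List.ofFn_succ', List.concat_eq_append, parityFin_eq_parityT M]
    unfold parityT
    rw [List.foldl_append, List.foldl_cons, List.foldl_nil]

/-- `(range M).map (g ∘ val)` is `ofFn g`. [folklore] -/
theorem map_range_eq_ofFn {α : Type*} {M : ℕ} (g : Fin M → α) (g' : ℕ → α) (h : ∀ i : Fin M, g i = g' i) :
    (List.range M).map g' = List.ofFn g := by
  rw [List.ofFn_eq_map]
  apply List.ext_getElem
  · simp
  · intro i h1 h2; simp [← h ⟨i, by simpa using h1⟩]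

/-- A sum of `bz`s in `𝔽₂` is the `bz` of the parity. [folklore] -/
theorem sum_bz_eq : ∀ (M : ℕ) (w : Fin M → Bool), (∑ c : Fin M, bz (w c)) = bz (parityT (List.ofFn w))
  | 0, _ => by simp [parityT, bz]
  | M + 1, w => by
    rw [Fin.sum_univ_castSucc, sum_bz_eq M, List.ofFn_succ', List.concat_eq_append]
    unfold parityT
    rw [List.foldl_append, List.foldl_cons, List.foldl_nil]
    generalize (List.foldl xor false (List.ofFn fun i : Fin M => w i.castSucc)) = a
    cases a <;> cases w (Fin.last M) <;> decide

/-- `bz a * [tb] = bz (tb && a)`. [folklore] -/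
theorem bz_mul_indicator (a tb : Bool) : bz a * (if tb then 1 else 0 : ZMod 2) = bz (tb && a) := by
  cases a <;> cases tb <;> decide

/-- `bz a + bz c = bz (a ⊕ c)`. [folklore] -/
theorem bz_add (a c : Bool) : bz a + bz c = bz (xor a c) := by
  cases a <;> cases c <;> decide

/-- `bz b ≠ 0 ↔ b`. [folklore] -/
theorem decide_bz_ne_zero (b : Bool) : decide (bz b ≠ 0) = b := by cases b <;> decide

/-- Reading a listed function inside its range. [folklore] -/
theorem getD_ofFn_val {α : Type*} {L : ℕ} (y : Fin L → α) (d : α) (p : Fin L) : (List.ofFn y).getD p.val d = y p := by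
  rw [List.getD_eq_getElem _ _ (by simp), List.getElem_ofFn]

/-- `((range n).map f).sum = ∑_{i<n} f i`. [folklore] -/
theorem sum_map_range {M : Type*} [AddCommMonoid M] (f : ℕ → M) : ∀ n : ℕ,
    ((List.range n).map f).sum = ∑ i ∈ Finset.range n, f i
  | 0 => by simp
  | n + 1 => by rw [List.range_succ, List.map_append, List.sum_append, sum_map_range f n, Finset.sum_range_succ]; simp

/-! ### The polynomial design positions -/

/-- `A_I(k) mod q`: the value at `k` of the polynomial with `0/1` coefficient string "the bits of `I`"
(degree `< ℓ`), reduced modulo `q`. [cite: CarmosinoImpagliazzoKabanetsKolokolova2016, §3.1] -/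
def polyValT (q ℓ I k : ℕ) : ℕ := ((List.range ℓ).map fun c => if I.testBit c then k ^ c else 0).sum % q

/-- **The position of coordinate `k` of block `I`** of the polynomial design in the universe `[q·q]`:
`A_I(k) mod q + q · k`. [cite: CarmosinoImpagliazzoKabanetsKolokolova2016, §3.1] -/
def cikkPosT (q ℓ I k : ℕ) : ℕ := polyValT q ℓ I k + q * k

/-- The underlying `Fin` of `ZMod q` through `ZMod.finEquiv`. [folklore] -/
theorem finEquiv_symm_val (q : ℕ) [NeZero q] (z : ZMod q) : (((ZMod.finEquiv q).toEquiv.symm z : Fin q) : ℕ) = z.val := by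
  obtain ⟨k, rfl⟩ := Nat.exists_eq_succ_of_ne_zero (NeZero.ne q)
  rfl

/-- **The blocks of `cikkDesign` are listed by `cikkPosT`.** [cite: CarmosinoImpagliazzoKabanetsKolokolova2016, §3.1] -/
theorem cikkDesign_val (q n' ℓ : ℕ) [Fact q.Prime] (hn : n' ≤ q) (I : ℕ) (k : Fin n') :
    ((cikkDesign q n' ℓ hn fun c : Fin ℓ => I.testBit c) k : ℕ) = cikkPosT q ℓ I k := by
  rw [cikkDesign]
  simp only [Function.Embedding.trans_apply, polyBlock_apply, evalPoints_apply, eval_ofFn_coeffVec]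
  unfold pairIndex pairEquiv
  simp only [Equiv.toEmbedding_apply, Equiv.trans_apply, Equiv.prodCongr_apply, Prod.map_apply,
    finProdFinEquiv_apply_val]
  rw [finEquiv_symm_val, finEquiv_symm_val, ZMod.val_cast_of_lt (lt_of_lt_of_le k.isLt hn)]
  unfold cikkPosT polyValT
  congr 1
  rw [← ZMod.val_natCast]
  congr 1
  rw [sum_map_range, Nat.cast_sum, ← Fin.sum_univ_eq_sum_range]
  refine Finset.sum_congr rfl fun j _ => ?_
  split_ifs <;> simp

/-- The blocks of the amplification, listed. [folklore] -/
theorem blocks_val (m n : ℕ) (I : Fin (kk m n)) (rr : Fin (N1 m)) :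
    ((blocks m n I) rr : ℕ) = cikkPosT (q1 m) (mH m n) I rr := by
  unfold blocks
  exact cikkDesign_val (q1 m) (N1 m) (mH m n) (q1_spec m).1 I rr

/-! ### The mildly hard bit, read off the table -/

/-- **The mildly hard bit of a listed input** `w`, for the function with table `r` of `m` variables and fuel
`N`: the (only) symbol of `coreTF ⟨w, tctx N m r⟩` (`false` if none). [cite: AroraBarakCC2009, Thm. 19.21] -/
def g1T (N m : ℕ) (r w : List Bool) : Bool := (coreTF (boolPair w (tctx N m r))).headD false

/-- **`g1T` is the mildly hard function** on honest inputs. [cite: ImpagliazzoKabanetsWigderson2002, Thm. 11] -/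
theorem g1T_ofFn {m : ℕ} (f₀ : (Fin m → Bool) → Bool) (η : ℕ) (hm : m ≤ MildHard.nOf η)
    (w' : Fin (MildHard.lenOf η) → Bool) {N : ℕ} (hN : 2 ^ MildHard.lenOf η ≤ N) :
    g1T N m (truthTable f₀) (List.ofFn w') = MildHardFn.mildFn f₀ η hm w' := by
  unfold g1T
  rw [coreTF_ofFn f₀ η hm w' hN]
  rfl

/-! ### Seed positions -/

/-- The `x`-field occupies the first `d` positions. [folklore] -/
theorem sidx_inl_val (N d mh : ℕ) (p : Fin d) : ((sidx N d mh) (Sum.inl p) : ℕ) = p := by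
  simp [sidx]

/-- The Hankel bits follow. [folklore] -/
theorem sidx_inr_inl_val (N d mh : ℕ) (c : Fin (N + mh)) : ((sidx N d mh) (Sum.inr (Sum.inl c)) : ℕ) = d + c := by
  simp [sidx]

/-- The shift bits come last. [folklore] -/
theorem sidx_inr_inr_val (N d mh : ℕ) (rr : Fin N) : ((sidx N d mh) (Sum.inr (Sum.inr rr)) : ℕ) = d + ((N + mh) + rr) := by
  simp [sidx, Nat.add_assoc]

/-! ### The query inputs and the amplified function -/

/-- **The `I`-th query input** of the amplification on the block seed `y` (a list of `q² + ((N + mh) + N)`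
bits): bit `rr` is `y[pos(I, rr)] ⊕ (Σ_{c<mh, bit_c(I)} y[q² + rr + c]) ⊕ y[q² + (N + mh) + rr]`.
[cite: Hirahara2022PartialMCSP, proof of Lemma 8.1 (z_{Sᵢ} ⊕ H(r)ᵢ)] -/
def inpT (q N mh I : ℕ) (y : List Bool) : List Bool :=
  (List.range N).map fun rr =>
    xor (y.getD (cikkPosT q mh I rr) false)
      (xor (parityT ((List.range mh).map fun c => I.testBit c && y.getD (q * q + (rr + c)) false))
        (y.getD (q * q + ((N + mh) + rr)) false))

/-- **The amplified bit** `⊕_{I < kk} g₁(w_I(y))` with fuel `N'`. [cite: Hirahara2022PartialMCSP, proof of Lemma 8.1 (Amp^f)] -/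
def ampT (N' m n : ℕ) (r y : List Bool) : Bool :=
  parityT ((List.range (kk m n)).map fun I => g1T N' m r (inpT (q1 m) (N1 m) (mH m n) I y))

/-- **The query inputs agree** with `IWAmp.inp` on the parsed seed. [cite: Hirahara2022PartialMCSP, proof of Lemma 8.1] -/
theorem inpT_ofFn (m n : ℕ) (I : Fin (kk m n)) (u : Fin (L2 m n) → Bool) :
    inpT (q1 m) (N1 m) (mH m n) I (List.ofFn u) = List.ofFn (IWAmp.inp (blocks m n) (hidx m n) I (parseSeed u)) := by
  unfold inpT
  refine map_range_eq_ofFn _ _ fun rr => ?_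
  unfold IWAmp.inp IWAmp.hitB Hankel.gen Hankel.mulVec parseSeed
  simp only
  congr 1
  · -- the `x`-field bit at the design position
    rw [← blocks_val m n I rr, ← sidx_inl_val (N1 m) (q1 m * q1 m) (mH m n), getD_ofFn_val]
  · -- the Hankel hit bit
    have hidx' : ∀ c : Fin (mH m n), hidx m n I c = if (I : ℕ).testBit c then 1 else 0 := fun c => rfl
    simp only [Pi.add_apply, hidx', bz_mul_indicator]
    rw [sum_bz_eq, bz_add, decide_bz_ne_zero]
    congr 2
    · symm
      refine map_range_eq_ofFn _ _ fun c => ?_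
      congr 1
      have hlt : rr.val + c.val < N1 m + mH m n := by omega
      rw [← sidx_inr_inl_val (N1 m) (q1 m * q1 m) (mH m n) ⟨rr + c, hlt⟩, getD_ofFn_val]
    · rw [← sidx_inr_inr_val (N1 m) (q1 m * q1 m) (mH m n) rr, getD_ofFn_val]

/-- **The amplified bit agrees** with `IKWGen.g2` (fuel `N' ≥ 2^{N₁}`). [cite: ImpagliazzoWigderson1997, Thm. 1] -/
theorem ampT_ofFn {m : ℕ} (f₀ : (Fin m → Bool) → Bool) (n : ℕ) {N' : ℕ} (hN' : 2 ^ N1 m ≤ N')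
    (u : Fin (L2 m n) → Bool) : ampT N' m n (truthTable f₀) (List.ofFn u) = g2 f₀ n u := by
  unfold ampT g2 ampFn IWAmp.amp
  rw [parityFin_eq_parityT]
  congr 1
  refine map_range_eq_ofFn _ _ fun I => ?_
  rw [inpT_ofFn m n I u]
  unfold g1
  exact (g1T_ofFn f₀ (eta m) (eta_spec m).2 _ hN').symm

/-! ### The NW blocks and the output string -/

/-- **The block of output `J`** read off the seed: positions `cikkPosT q ℓ J x`, `x < L`. [cite: NisanWigderson1994, §2] -/
def blockT (q ℓ L J : ℕ) (sl : List Bool) : List Bool := (List.range L).map fun x => sl.getD (cikkPosT q ℓ J x) false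

/-- **The blocks agree** with the restriction of the seed through the output design. [cite: NisanWigderson1994, §2] -/
theorem blockT_ofFn (m n K : ℕ) (hK : seedLen m n ≤ K) (s : Fin K → Bool) (J : Fin n) :
    blockT (q2 m n) (ell n) (L2 m n) J (List.ofFn s) =
      List.ofFn ((fun p : Fin (seedLen m n) => s (Fin.castLE hK p)) ∘
        cikkDesign (q2 m n) (L2 m n) (ell n) (q2_spec m n).1 fun c : Fin (ell n) => (J : ℕ).testBit c) := by
  unfold blockT
  refine map_range_eq_ofFn _ _ fun x => ?_
  simp only [Function.comp_apply]
  rw [← cikkDesign_val (q2 m n) (L2 m n) (ell n) (q2_spec m n).1 J x]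
  exact (getD_ofFn_val s false (Fin.castLE hK _)).symm

/-- The arity read off the table length: `m = ⌊log₂ |r|⌋`. [folklore] -/
def mOfT (r : List Bool) : ℕ := Nat.log 2 r.length

/-- The arity of a truth table. [folklore] -/
theorem mOfT_truthTable {m : ℕ} (f₀ : (Fin m → Bool) → Bool) : mOfT (truthTable f₀) = m := by
  unfold mOfT; rw [length_truthTable, Nat.log_pow one_lt_two]

/-- **The output string** of the generator on `(r, n, sl)` with fuel `N'`: the `n` amplified bits of the blocks
of the seed, or `0ⁿ` if the seed is shorter than `seedLen`. [cite: ImpagliazzoKabanetsWigderson2002, Thm. 11] -/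
def genStrT (N' : ℕ) (r : List Bool) (n : ℕ) (sl : List Bool) : List Bool :=
  if seedLen (mOfT r) n ≤ sl.length then
    (List.range n).map fun J => ampT N' (mOfT r) n r (blockT (q2 (mOfT r) n) (ell n) (L2 (mOfT r) n) J sl)
  else List.replicate n false

/-- The output string has length `n`. [folklore] -/
theorem length_genStrT (N' : ℕ) (r : List Bool) (n : ℕ) (sl : List Bool) : (genStrT N' r n sl).length = n := by
  unfold genStrT; split_ifs <;> simp

/-- **The output string is the generator `IKWGen.genPad`** (fuel `N' ≥ 2^{N₁(m)}`).
[cite: ImpagliazzoKabanetsWigderson2002, Thm. 11] -/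
theorem genStrT_getD {m : ℕ} (f₀ : (Fin m → Bool) → Bool) (n K : ℕ) {N' : ℕ} (hN' : 2 ^ N1 m ≤ N')
    (s : Fin K → Bool) (i : Fin n) :
    (genStrT N' (truthTable f₀) n (List.ofFn s)).getD i false = genPad f₀ n K s i := by
  unfold genStrT genPad
  rw [mOfT_truthTable, List.length_ofFn]
  by_cases hK : seedLen m n ≤ K
  · rw [if_pos hK, dif_pos hK, List.getD_eq_getElem _ _ (by simp), List.getElem_map, List.getElem_range,
      blockT_ofFn m n K hK s i, ampT_ofFn f₀ n hN']
    rfl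
  · rw [if_neg hK, dif_neg hK, List.getD_eq_getElem _ _ (by simp), List.getElem_replicate]

/-! ## (B) The generator on codes -/

open _root_.Computability Polynomial Brick MildHard CodeFP


/-! ### Generic helpers -/

/-- Reading a bit of a string at a unary position (default `false` past the end). [cite: AroraBarakCC2009, §1.3] -/
theorem bitRead : CodeFP (pairE unE strE) bitE (fun p => p.2.getD p.1 false) := by
  refine ⟨iteFn isNilFn (fun _ => [false]) _root_.id ∘ bitAtFn,
    comp_mem_FP (iteFn_mem_FP isNilFn_mem_FP (const_mem_FP _) (PolyTimeComputable.id _)) bitAtFn_mem_FP, fun p => ?_⟩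
  obtain ⟨i, r⟩ := p
  rw [pairE_apply, Function.comp_apply]
  change iteFn isNilFn (fun _ => [false]) _root_.id (bitAtFn (boolPair (unE i) r)) = bitE (r.getD i false)
  rw [bitAtFn_boolPair, length_unE]
  rcases lt_or_ge i r.length with h | h
  · rw [List.take_one_drop_eq_of_lt_length h, iteFn_apply (b := false) (by rfl)]
    change [r[i]] = bitE (r.getD i false)
    rw [List.getD_eq_getElem _ _ h]; rfl
  · rw [List.drop_eq_nil_of_le h, List.take_nil, iteFn_apply (b := true) (by rfl)]
    change [false] = bitE (r.getD i false)
    rw [List.getD_eq_default _ _ h]; rfl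

/-- Reading a bit of a string at a binary position (capped by the length first). [cite: AroraBarakCC2009, §1.3] -/
theorem bitReadNat : CodeFP (pairE natE strE) bitE (fun p => p.2.getD p.1 false) := by
  have hpos : CodeFP (pairE natE strE) unE (fun p => min p.1 p.2.length) :=
    (unOfNatMin.comp ((strLength.comp (snd _ _)).pair (fst _ _)) :)
  exact (bitRead.comp (hpos.pair (snd _ _))).congr fun p => by
    rcases le_or_gt p.1 p.2.length with h | h
    · rw [min_eq_left h]
    · rw [min_eq_right h.le, List.getD_eq_default _ _ le_rfl, List.getD_eq_default _ _ h.le]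

/-- Reading a listed bit at a binary position (default `false`). [folklore] -/
theorem getBit : CodeFP (pairE (rawE bitE) natE) bitE (fun p => p.1.getD p.2 false) :=
  (rawGetOr bitE).comp ((fst _ _).pair ((snd _ _).pair (const _ false)))

/-- Parity of a raw bit list. [folklore] -/
theorem codeFP_parityT : CodeFP (rawE bitE) bitE parityT := by
  have h := foldl₀ (eα := bitE) (step := fun (b : Bool) (acc : Bool) => xor acc b) (b₀ := false)
    (xorBit.comp ((snd _ _).pair (fst _ _))) 1 (fun l₁ l₂ => by simp [bitE])
  exact h.congr fun l => rfl

/-- A binary digit: `(i, p) ↦ bit_p(i)` (`i` binary, `p` unary). [folklore] -/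
theorem codeFP_testBit : CodeFP (pairE natE unE) bitE (fun q => q.1.testBit q.2) := by
  have h : CodeFP (pairE natE unE) bitE (fun q => decide (q.1 / 2 ^ q.2 % 2 = 1)) :=
    (natEq.comp ((natMod.comp ((natDiv.comp ((fst _ _).pair (natPow.comp ((const _ (2 : ℕ)).pair (snd _ _))))).pair
      (const _ (2 : ℕ)))).pair (const _ (1 : ℕ))) :)
  exact h.congr fun q => by rw [Nat.testBit_eq_decide_div_mod_eq]

/-- The appending fold rebuilds the list. [folklore] -/
theorem foldl_append_singleton_eq (l acc : List Bool) : l.foldl (fun acc b => acc ++ [b]) acc = acc ++ l := by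
  induction l generalizing acc with
  | nil => simp
  | cons b l ih => rw [List.foldl_cons, ih]; simp

/-- A raw list of bits as a string (change of code `rawE bitE → strE`). [folklore] -/
theorem bitsToStr : CodeFP (rawE bitE) strE (fun l => l) := by
  have hsing : CodeFP bitE strE (fun b : Bool => [b]) := transparent fun _ => rfl
  have hstep : CodeFP (pairE bitE strE) strE (fun t => t.2 ++ [t.1]) :=
    (strAppend.comp ((snd _ _).pair (hsing.comp (fst _ _))) :)
  have h := foldl₀ (step := fun (b : Bool) (acc : List Bool) => acc ++ [b]) (b₀ := []) hstep X (fun l₁ l₂ => by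
    rw [foldl_append_singleton_eq, List.nil_append, eval_X]
    have h1 := length_le_length_rawE bitE (l₁ ++ l₂)
    rw [List.length_append] at h1
    change l₁.length ≤ _
    omega)
  exact h.congr fun l => by rw [foldl_append_singleton_eq, List.nil_append]

/-- `Option.getD` with default `0` on an optional numeral. [folklore] -/
theorem optGetDZero : CodeFP (optE natE) natE (fun o => o.getD 0) := by
  have h := optCases (σ := Unit) (eσ := fun _ => []) (eα := natE) (eδ := natE) (k := fun _ o => o.getD 0)
    (gnone := fun _ => 0) (gsome := fun t => t.2) (const _ 0) (snd _ _) (fun _ => rfl) (fun _ _ => rfl)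
  exact (h.comp ((const _ ()).pair (CodeFP.id _))).congr fun _ => rfl

/-- The first index of a range satisfying a predicate is its least witness. [folklore] -/
theorem find?_range_eq_some {P : ℕ → Bool} {e : ℕ} : ∀ {N : ℕ}, e < N → P e = true → (∀ j < e, P j = false) →
    (List.range N).find? P = some e
  | 0, h, _, _ => absurd h (Nat.not_lt_zero e)
  | N + 1, heN, hP, hmin => by
    rw [List.range_succ, List.find?_append]
    rcases Nat.lt_succ_iff_lt_or_eq.1 heN with h | h
    · rw [find?_range_eq_some h hP hmin]; rfl
    · subst h
      have hnone : (List.range e).find? P = none :=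
        List.find?_eq_none.2 fun j hj => by rw [hmin j (List.mem_range.1 hj)]; decide
      rw [hnone]
      simp [hP]

/-! ### The inputs and the master budget -/

/-- Inputs `(r, n, sl)`: truth table, output length, seed. [folklore] -/
abbrev In : Type := List Bool × (ℕ × List Bool)

/-- Their code `⟨r, ⟨1ⁿ, sl⟩⟩` (the argument of `tableGenerator`). [folklore] -/
abbrev inE : In → List Bool := pairE strE (pairE unE strE)

/-- The size yardstick `S = |r| + n + 2`. [folklore] -/
def ST (c : In) : ℕ := c.1.length + c.2.1 + 2

/-- **The master budget** `B = S^60` (range caps and fuel). [folklore] -/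
def BT (c : In) : ℕ := ST c ^ 60

/-- `S ≥ 2`. [folklore] -/
theorem two_le_ST (c : In) : 2 ≤ ST c := by unfold ST; omega

/-- Powers of `S` up to the sixtieth are within the budget. [folklore] -/
theorem pow_le_BT (c : In) {k : ℕ} (hk : k ≤ 60) : ST c ^ k ≤ BT c :=
  Nat.pow_le_pow_right (by have := two_le_ST c; omega) hk

/-- Transferring a bound by a power of `S`. [folklore] -/
theorem le_BT (c : In) {x k : ℕ} (hk : k ≤ 60) (h : x ≤ ST c ^ k) : x ≤ BT c := h.trans (pow_le_BT c hk)

/-- Small multiples of powers: `a · S^k ≤ S^(k+j)` once `a ≤ 2^j`. [folklore] -/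
theorem mul_pow_le_pow (c : In) {a k j : ℕ} (ha : a ≤ 2 ^ j) : a * ST c ^ k ≤ ST c ^ (k + j) := by
  rw [pow_add, mul_comm]
  exact Nat.mul_le_mul_left _ (ha.trans (Nat.pow_le_pow_left (two_le_ST c) j))

/-- `m = ⌊log₂ |r|⌋ ≤ |r|`. [folklore] -/
theorem mOfT_le_length (r : List Bool) : mOfT r ≤ r.length := Nat.log_le_self 2 r.length

/-- `m + 2 ≤ S`. [folklore] -/
theorem mOfT_add_two_le_ST (c : In) : mOfT c.1 + 2 ≤ ST c := by
  unfold ST; have := mOfT_le_length c.1; omega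

/-- `m < S`. [folklore] -/
theorem mOfT_lt_ST (c : In) : mOfT c.1 < ST c := by have := mOfT_add_two_le_ST c; omega

/-- `|r| ≤ B`. [folklore] -/
theorem length_le_BT (c : In) : c.1.length ≤ BT c :=
  le_BT c (k := 1) (by norm_num) (by unfold ST; rw [pow_one]; omega)

/-- `T = n + m + 2 ≤ S`. [folklore] -/
theorem T_le_ST (c : In) : T (mOfT c.1) c.2.1 ≤ ST c := by
  unfold T ST; have := mOfT_le_length c.1; omega

/-- `2^m ≤ S`. [folklore] -/
theorem two_pow_mOfT_le_ST (c : In) : 2 ^ mOfT c.1 ≤ ST c := by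
  unfold mOfT ST
  rcases Nat.eq_zero_or_pos c.1.length with h | h
  · rw [h]; simp
  · have := Nat.pow_log_le_self 2 h.ne'; omega

/-- `N₁ ≤ S⁶`. [folklore] -/
theorem N1_le_pow (c : In) : N1 (mOfT c.1) ≤ ST c ^ 6 := by
  have h1 := N1_le (mOfT c.1)
  have h3 : 17 * (mOfT c.1 + 2) ≤ 17 * ST c := Nat.mul_le_mul_left _ (mOfT_add_two_le_ST c)
  calc N1 (mOfT c.1) ≤ 17 * ST c ^ 1 := by rw [pow_one]; exact h1.trans h3
    _ ≤ ST c ^ (1 + 5) := mul_pow_le_pow c (by norm_num)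

/-- `κ ≤ 2³¹`. [folklore] -/
theorem κ_le : κ ≤ 2 ^ 31 := by rw [κ_def]; norm_num

/-- `kk ≤ S⁴⁰`. [folklore] -/
theorem kk_le_pow (c : In) : kk (mOfT c.1) c.2.1 ≤ ST c ^ 40 := by
  have h1 := kk_le (mOfT c.1) c.2.1
  have h2 : T (mOfT c.1) c.2.1 ^ 9 ≤ ST c ^ 9 := Nat.pow_le_pow_left (T_le_ST c) 9
  calc kk (mOfT c.1) c.2.1 ≤ κ * ST c ^ 9 := h1.trans (Nat.mul_le_mul_left _ h2)
    _ ≤ ST c ^ (9 + 31) := mul_pow_le_pow c κ_le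

/-- `mH ≤ S⁴¹`. [folklore] -/
theorem mH_le_pow (c : In) : mH (mOfT c.1) c.2.1 ≤ ST c ^ 41 := by
  have h1 := kk_le_pow c
  have h2 := Nat.log_le_self 2 (kk (mOfT c.1) c.2.1)
  unfold mH
  calc Nat.log 2 (kk (mOfT c.1) c.2.1) + 1 ≤ ST c ^ 40 + ST c ^ 40 := by
        have : 1 ≤ ST c ^ 40 := Nat.one_le_pow _ _ (by have := two_le_ST c; omega)
        omega
    _ = 2 * ST c ^ 40 := by ring
    _ ≤ ST c ^ (40 + 1) := mul_pow_le_pow c (by norm_num)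

/-- `L₂ ≤ S⁴³`. [folklore] -/
theorem L2_le_pow (c : In) : L2 (mOfT c.1) c.2.1 ≤ ST c ^ 43 := by
  have hN := N1_le_pow c
  have hq : q1 (mOfT c.1) ≤ 2 * ST c ^ 6 := (q1_spec (mOfT c.1)).2.2.trans (Nat.mul_le_mul_left _ hN)
  have hq' : q1 (mOfT c.1) ≤ ST c ^ 7 := hq.trans (mul_pow_le_pow c (j := 1) (by norm_num))
  have hmH := mH_le_pow c
  have hS := two_le_ST c
  have h6 : ST c ^ 6 ≤ ST c ^ 41 := Nat.pow_le_pow_right (by omega) (by norm_num)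
  have h14 : ST c ^ 7 * ST c ^ 7 ≤ ST c ^ 41 := by
    rw [← pow_add]; exact Nat.pow_le_pow_right (by omega) (by norm_num)
  unfold L2
  calc q1 (mOfT c.1) * q1 (mOfT c.1) + ((N1 (mOfT c.1) + mH (mOfT c.1) c.2.1) + N1 (mOfT c.1))
      ≤ ST c ^ 7 * ST c ^ 7 + ((ST c ^ 6 + ST c ^ 41) + ST c ^ 6) := by gcongr
    _ ≤ 4 * ST c ^ 41 := by omega
    _ ≤ ST c ^ (41 + 2) := mul_pow_le_pow c (by norm_num)

/-- `2^{N₁} ≤ S⁵¹` (the fuel of the table brick). [folklore] -/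
theorem two_pow_N1_le_pow (c : In) : 2 ^ N1 (mOfT c.1) ≤ ST c ^ 51 := by
  have h1 := N1_le (mOfT c.1)
  have h2 := two_pow_mOfT_le_ST c
  have hS := two_le_ST c
  have h4 : 4 ≤ ST c ^ 2 := by
    calc 4 = 2 ^ 2 := by norm_num
      _ ≤ ST c ^ 2 := Nat.pow_le_pow_left hS 2
  calc 2 ^ N1 (mOfT c.1) ≤ 2 ^ (17 * (mOfT c.1 + 2)) := Nat.pow_le_pow_right (by norm_num) h1
    _ = (2 ^ mOfT c.1 * 4) ^ 17 := by rw [pow_mul', pow_add]; norm_num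
    _ ≤ (ST c * ST c ^ 2) ^ 17 := by gcongr
    _ = ST c ^ 51 := by rw [← pow_succ', ← pow_mul]

/-! The budget has a large literal exponent and must never be unfolded by the unifier (a `whnf` of
`(|r| + n + 2)^60` in `List.replicate (BT c) ()` recurses on the literal); it is irreducible from here on,
as `budgetT` in `HiraharaMachineEvalFP.lean`. -/
attribute [irreducible] BT

/-! ### The parameters on codes -/

/-- The table. [folklore] -/
theorem cR : CodeFP inE strE (fun c => c.1) := fst _ _
/-- The output length, unary. [folklore] -/
theorem cNun : CodeFP inE unE (fun c => c.2.1) := (snd _ _).fst'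
/-- The output length, binary. [folklore] -/
theorem cN : CodeFP inE natE (fun c => c.2.1) := (natOfUn.comp cNun).congr fun _ => rfl
/-- The seed. [folklore] -/
theorem cSl : CodeFP inE strE (fun c => c.2.2) := (snd _ _).snd'

/-- The yardstick `S` in unary. [folklore] -/
theorem codeFP_ST : CodeFP inE unE ST :=
  ((unAdd.comp ((unAdd.comp ((strLength.comp cR).pair cNun)).pair (const inE (2 : ℕ)))) :).congr fun c => by
    unfold ST; rfl

/-- The budget as units. [folklore] -/
theorem codeFP_BTunits : CodeFP inE (rawE unitE) (fun c => List.replicate (BT c) ()) :=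
  ((unitsPow 60).comp codeFP_ST).congr fun c => by unfold BT; rfl

/-- **The budget `B` in unary.** [folklore] -/
theorem codeFP_BT : CodeFP inE unE BT :=
  ((ulength unitE).comp codeFP_BTunits).congr fun c => by rw [List.length_replicate]

/-- **The arity `m = ⌊log₂ |r|⌋`** (binary). [folklore] -/
theorem codeFP_mOfT : CodeFP inE natE (fun c => mOfT c.1) := by
  have h : CodeFP inE natE (fun c => min (List.replicate (BT c) ()).length (Nat.log 2 c.1.length)) :=
    (natLog2Min.comp ((strNatLength.comp cR).pair codeFP_BTunits) :)
  refine h.congr fun c => ?_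
  rw [List.length_replicate]
  unfold mOfT
  exact min_eq_right ((Nat.log_le_self 2 _).trans (length_le_BT c))

/-- `m ≤ B`. [folklore] -/
theorem mOfT_le_BT (c : In) : mOfT c.1 ≤ BT c := (mOfT_le_length c.1).trans (length_le_BT c)

/-- The arity, unary. [folklore] -/
theorem codeFP_mOfT_un : CodeFP inE unE (fun c => mOfT c.1) :=
  ((unOfNatMin.comp (codeFP_BT.pair codeFP_mOfT)) :).congr fun c => min_eq_left (mOfT_le_BT c)

/-! #### The scale `η` by a bounded search -/

/-- The search predicate of the scale: `2 ≤ η ∧ m ≤ 2^η · η` (the power through a unary `min η B`). [folklore] -/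
def etaP (B m η : ℕ) : Bool := decide (2 ≤ η) && decide (m ≤ 2 ^ min η B * η)

/-- **The scale search**: the first `η < min (m + 3) B` satisfying `etaP`. [folklore] -/
def etaSearchT (B m : ℕ) : ℕ := (((List.range (min (m + 3) B)).find? (etaP B m))).getD 0

open Classical in
/-- `η(m) ≤ m + 2`. [folklore] -/
theorem eta_le_add_two (m : ℕ) : eta m ≤ m + 2 := by
  refine Nat.find_min' (exists_scale m) ⟨by omega, ?_⟩
  unfold nOf kOf
  calc m ≤ m + 2 := by omega
    _ ≤ 2 ^ (m + 2) * (m + 2) := Nat.le_mul_of_pos_left _ Nat.one_le_two_pow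

open Classical in
/-- **The search finds the scale.** [folklore] -/
theorem etaSearchT_eq {B m : ℕ} (hB : m + 3 ≤ B) : etaSearchT B m = eta m := by
  have he := eta_le_add_two m
  unfold etaSearchT
  rw [min_eq_left hB, find?_range_eq_some (e := eta m) (by omega) ?_ ?_]
  · rfl
  · obtain ⟨h2, hm⟩ := eta_spec m
    unfold nOf kOf at hm
    unfold etaP
    rw [min_eq_left (by omega)]
    simp [h2, hm]
  · intro j hj
    unfold etaP
    rw [min_eq_left (by omega)]
    by_cases h2 : 2 ≤ j
    · have := nOf_lt_of_lt_eta h2 hj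
      unfold nOf kOf at this
      simp [not_le.2 this]
    · simp [h2]

/-- **The scale on codes.** [folklore] -/
theorem codeFP_eta : CodeFP inE natE (fun c => eta (mOfT c.1)) := by
  -- item `η`, context `c`
  have iB : CodeFP (pairE inE natE) unE (fun s => BT s.1) := codeFP_BT.comp (fst _ _)
  have iM : CodeFP (pairE inE natE) natE (fun s => mOfT s.1.1) := codeFP_mOfT.comp (fst _ _)
  have iEta : CodeFP (pairE inE natE) unE (fun s => min s.2 (BT s.1)) := (unOfNatMin.comp (iB.pair (snd _ _)) :)
  have iPow : CodeFP (pairE inE natE) natE (fun s => 2 ^ min s.2 (BT s.1) * s.2) :=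
    (natMul.comp ((natPow.comp ((const _ (2 : ℕ)).pair iEta)).pair (snd _ _)) :)
  have iP : CodeFP (pairE inE natE) bitE (fun s => etaP (BT s.1) (mOfT s.1.1) s.2) :=
    ((natLe.comp ((const _ (2 : ℕ)).pair (snd _ _))).and (natLe.comp (iM.pair iPow))).congr fun s => by unfold etaP; rfl
  have hR : CodeFP inE (rawE natE) (fun c => List.range (min (mOfT c.1 + 3) (BT c))) :=
    (rangeOf.comp (codeFP_BT.pair (natAdd.comp (codeFP_mOfT.pair (const _ (3 : ℕ))))) :)
  have hF : CodeFP inE (optE natE) (fun c => (List.range (min (mOfT c.1 + 3) (BT c))).find? (etaP (BT c) (mOfT c.1))) :=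
    ((rawFind? iP).comp ((CodeFP.id inE).pair hR) :)
  refine ((optGetDZero.comp hF).congr fun c => ?_)
  have hB : mOfT c.1 + 3 ≤ BT c := le_BT c (k := 2) (by norm_num) (by
    have := mOfT_add_two_le_ST c; have := two_le_ST c; nlinarith)
  exact etaSearchT_eq hB

/-- The scale, unary. [folklore] -/
theorem codeFP_eta_un : CodeFP inE unE (fun c => eta (mOfT c.1)) :=
  ((unOfNatMin.comp (codeFP_BT.pair codeFP_eta)) :).congr fun c =>
    min_eq_left (le_BT c (k := 1) (by norm_num) (by
      rw [pow_one]; have := eta_le_add_two (mOfT c.1); have := mOfT_add_two_le_ST c; omega))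

/-- **`N₁ = 2^η (2η + 2) + (2η + 2)` on codes.** [folklore] -/
theorem codeFP_N1 : CodeFP inE natE (fun c => N1 (mOfT c.1)) := by
  have h2e : CodeFP inE natE (fun c => 2 * eta (mOfT c.1) + 2) :=
    (natAdd.comp ((natMul.comp ((const _ (2 : ℕ)).pair codeFP_eta)).pair (const _ (2 : ℕ))) :)
  have h : CodeFP inE natE (fun c => 2 ^ eta (mOfT c.1) * (2 * eta (mOfT c.1) + 2) + (2 * eta (mOfT c.1) + 2)) :=
    (natAdd.comp ((natMul.comp ((natPow.comp ((const _ (2 : ℕ)).pair codeFP_eta_un)).pair h2e)).pair h2e) :)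
  exact h.congr fun c => by unfold N1 MildHard.lenOf MildHard.kOf; rw [MildHard.MOf_succ]

/-- `N₁`, unary. [folklore] -/
theorem codeFP_N1_un : CodeFP inE unE (fun c => N1 (mOfT c.1)) :=
  ((unOfNatMin.comp (codeFP_BT.pair codeFP_N1)) :).congr fun c => min_eq_left (le_BT c (by norm_num) (N1_le_pow c))

/-- **`ℓ = ⌊log₂ n⌋ + 1` on codes.** [folklore] -/
theorem codeFP_ell : CodeFP inE natE (fun c => ell c.2.1) := by
  have h : CodeFP inE natE (fun c => min (List.replicate (BT c) ()).length (Nat.log 2 c.2.1) + 1) :=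
    (natAdd.comp ((natLog2Min.comp (cN.pair codeFP_BTunits)).pair (const _ (1 : ℕ))) :)
  refine h.congr fun c => ?_
  rw [List.length_replicate]
  unfold ell
  rw [min_eq_right]
  exact (Nat.log_le_self 2 _).trans (le_BT c (k := 1) (by norm_num) (by unfold ST; rw [pow_one]; omega))

/-- `ℓ ≤ S`. [folklore] -/
theorem ell_le_ST (c : In) : ell c.2.1 ≤ ST c := by
  unfold ell ST; have := Nat.log_le_self 2 c.2.1; omega

/-- `ℓ`, unary. [folklore] -/
theorem codeFP_ell_un : CodeFP inE unE (fun c => ell c.2.1) :=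
  ((unOfNatMin.comp (codeFP_BT.pair codeFP_ell)) :).congr fun c =>
    min_eq_left (le_BT c (k := 1) (by norm_num) (by rw [pow_one]; exact ell_le_ST c))

/-- **`S₂ = n (n · univBound ℓ + n + 2)` on codes** (`univBound ℓ = 5 · 2^ℓ − 4`). [folklore] -/
theorem codeFP_S2 : CodeFP inE natE (fun c => S2 c.2.1) := by
  have hU : CodeFP inE natE (fun c => 5 * 2 ^ ell c.2.1 - 4) :=
    (natSub.comp ((natMul.comp ((const _ (5 : ℕ)).pair (natPow.comp ((const _ (2 : ℕ)).pair codeFP_ell_un)))).pair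
      (const _ (4 : ℕ))) :)
  have hU' : CodeFP inE natE (fun c => univBound (ell c.2.1)) := hU.congr fun c => by
    have := Literature.Computability.AlgebraicComplexity.RazMonomialCkt.univBound_add_four (ell c.2.1); omega
  have h : CodeFP inE natE (fun c => c.2.1 * (c.2.1 * univBound (ell c.2.1) + c.2.1 + 2)) :=
    (natMul.comp (cN.pair (natAdd.comp ((natAdd.comp ((natMul.comp (cN.pair hU')).pair cN)).pair (const _ (2 : ℕ))))) :)
  exact h.congr fun c => by unfold S2; rfl

/-- **`kk = 6 S₂ N₁⁶` on codes.** [folklore] -/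
theorem codeFP_kk : CodeFP inE natE (fun c => kk (mOfT c.1) c.2.1) := by
  have h : CodeFP inE natE (fun c => 6 * S2 c.2.1 * N1 (mOfT c.1) ^ 6) :=
    (natMul.comp ((natMul.comp ((const _ (6 : ℕ)).pair codeFP_S2)).pair (natPow.comp (codeFP_N1.pair (const inE (6 : ℕ))))) :)
  exact h.congr fun c => by unfold kk; rfl

/-- `kk`, unary. [folklore] -/
theorem codeFP_kk_un : CodeFP inE unE (fun c => kk (mOfT c.1) c.2.1) :=
  ((unOfNatMin.comp (codeFP_BT.pair codeFP_kk)) :).congr fun c => min_eq_left (le_BT c (by norm_num) (kk_le_pow c))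

/-- **`mH = ⌊log₂ kk⌋ + 1` on codes.** [folklore] -/
theorem codeFP_mH : CodeFP inE natE (fun c => mH (mOfT c.1) c.2.1) := by
  have h : CodeFP inE natE (fun c => min (List.replicate (BT c) ()).length (Nat.log 2 (kk (mOfT c.1) c.2.1)) + 1) :=
    (natAdd.comp ((natLog2Min.comp (codeFP_kk.pair codeFP_BTunits)).pair (const _ (1 : ℕ))) :)
  refine h.congr fun c => ?_
  rw [List.length_replicate]
  unfold mH
  rw [min_eq_right]
  exact (Nat.log_le_self 2 _).trans (le_BT c (by norm_num) (kk_le_pow c))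

/-- `mH`, unary. [folklore] -/
theorem codeFP_mH_un : CodeFP inE unE (fun c => mH (mOfT c.1) c.2.1) :=
  ((unOfNatMin.comp (codeFP_BT.pair codeFP_mH)) :).congr fun c => min_eq_left (le_BT c (by norm_num) (mH_le_pow c))

/-! #### The primes by trial division -/

/-- Trial division within a budget: `2 ≤ p` and no `d < min p B` with `2 ≤ d ∣ p`. [folklore] -/
def primeBT (B p : ℕ) : Bool :=
  decide (2 ≤ p) && (List.range (min p B)).all fun d => decide (d < 2) || !decide (p % d = 0)

/-- **Trial division decides primality** (within the budget). [folklore] -/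
theorem primeBT_iff {B p : ℕ} (hp : p ≤ B) : primeBT B p = true ↔ p.Prime := by
  unfold primeBT
  rw [min_eq_left hp, Nat.prime_def_lt]
  simp only [Bool.and_eq_true, decide_eq_true_eq, List.all_eq_true, List.mem_range, Bool.or_eq_true, Bool.not_eq_true',
    decide_eq_false_iff_not]
  constructor
  · rintro ⟨h2, h⟩
    refine ⟨h2, fun d hd hdvd => ?_⟩
    rcases h d hd with h' | h'
    · interval_cases d
      · rw [zero_dvd_iff] at hdvd; omega
      · rfl
    · exact absurd (Nat.mod_eq_zero_of_dvd hdvd) h'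
  · rintro ⟨h2, h⟩
    refine ⟨h2, fun d hd => ?_⟩
    by_cases hd2 : d < 2
    · exact Or.inl hd2
    · refine Or.inr fun hmod => ?_
      have := h d hd (Nat.dvd_of_mod_eq_zero hmod)
      omega

/-- **The least prime `≥ N` by search** over `[0, min (2N + 3) B)`. [folklore] -/
def lpgSearchT (B N : ℕ) : ℕ := (((List.range (min (2 * N + 3) B)).find? fun p => decide (N ≤ p) && primeBT B p)).getD 0

/-- `leastPrimeGe N ≤ 2N + 2` (Bertrand for `N ≥ 1`; `2` for `N = 0`). [folklore] -/
theorem leastPrimeGe_le_two_mul_add_two (N : ℕ) : leastPrimeGe N ≤ 2 * N + 2 := by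
  rcases Nat.eq_zero_or_pos N with rfl | hN
  · exact Nat.find_min' _ ⟨Nat.zero_le _, Nat.prime_two⟩
  · exact (leastPrimeGe_le N hN.ne').trans (by omega)

/-- **The search finds the least prime `≥ N`.** [folklore] -/
theorem lpgSearchT_eq {B N : ℕ} (hB : 2 * N + 3 ≤ B) : lpgSearchT B N = leastPrimeGe N := by
  have hle := leastPrimeGe_le_two_mul_add_two N
  obtain ⟨hge, hprime⟩ := leastPrimeGe_spec N
  unfold lpgSearchT
  rw [min_eq_left hB, find?_range_eq_some (e := leastPrimeGe N) (by omega) ?_ ?_]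
  · rfl
  · rw [Bool.and_eq_true, decide_eq_true_eq, primeBT_iff (by omega)]
    exact ⟨hge, hprime⟩
  · intro j hj
    rw [Bool.and_eq_false_iff]
    by_cases hNj : N ≤ j
    · refine Or.inr ?_
      rw [Bool.eq_false_iff]
      intro hpj
      rw [primeBT_iff (by omega)] at hpj
      have := Nat.find_min' (Nat.exists_infinite_primes N) ⟨hNj, hpj⟩
      unfold leastPrimeGe at hj
      omega
    · exact Or.inl (decide_eq_false hNj)

/-- **The prime search on codes**: `(B, N) ↦ lpgSearchT B N` (`B` unary, `N` binary). [folklore] -/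
theorem codeFP_lpgSearch : CodeFP (pairE unE natE) natE (fun p => lpgSearchT p.1 p.2) := by
  -- item `p'` (candidate), context `(B, N)`; inner item `d`, context `((B, N), p')`
  let cE : ℕ × ℕ → List Bool := pairE unE natE
  let dE : (ℕ × ℕ) × ℕ → List Bool := pairE cE natE
  have dB : CodeFP dE unE (fun s => s.1.1) := (fst _ _).fst'
  have dP : CodeFP dE natE (fun s => s.2) := snd _ _
  have uP : CodeFP (pairE dE natE) natE (fun u => u.1.2) := (fst _ _).snd'
  have uD : CodeFP (pairE dE natE) natE (fun u => u.2) := snd _ _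
  have uT : CodeFP (pairE dE natE) bitE (fun u => decide (u.2 < 2) || !decide (u.1.2 % u.2 = 0)) :=
    (natLt.comp (uD.pair (const _ (2 : ℕ)))).or (natEq.comp ((natMod.comp (uP.pair uD)).pair (const _ (0 : ℕ)))).not
  have dAll : CodeFP dE bitE (fun s => (List.range (min s.2 s.1.1)).all fun d => decide (d < 2) || !decide (s.2 % d = 0)) :=
    ((all uT).comp ((CodeFP.id dE).pair (rangeOf.comp (dB.pair dP))) :)
  have dPrime : CodeFP dE bitE (fun s => primeBT s.1.1 s.2) :=
    ((natLe.comp ((const _ (2 : ℕ)).pair dP)).and dAll).congr fun s => by unfold primeBT; rfl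
  have dPred : CodeFP dE bitE (fun s => decide (s.1.2 ≤ s.2) && primeBT s.1.1 s.2) :=
    (natLe.comp (((fst _ _).snd').pair dP)).and dPrime
  have hR : CodeFP cE (rawE natE) (fun p => List.range (min (2 * p.2 + 3) p.1)) :=
    (rangeOf.comp ((fst _ _).pair (natAdd.comp ((natMul.comp ((const _ (2 : ℕ)).pair (snd _ _))).pair (const _ (3 : ℕ))))) :)
  have hF : CodeFP cE (optE natE) (fun p => (List.range (min (2 * p.2 + 3) p.1)).find? fun p' => decide (p.2 ≤ p') && primeBT p.1 p') :=
    ((rawFind? dPred).comp ((CodeFP.id cE).pair hR) :)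
  exact (optGetDZero.comp hF).congr fun p => by unfold lpgSearchT; rfl

/-- **`q₁ = leastPrimeGe N₁` on codes.** [folklore] -/
theorem codeFP_q1 : CodeFP inE natE (fun c => q1 (mOfT c.1)) :=
  ((codeFP_lpgSearch.comp (codeFP_BT.pair codeFP_N1)) :).congr fun c => by
    unfold q1
    exact lpgSearchT_eq (le_BT c (k := 8) (by norm_num) (by
      have h := N1_le_pow c
      have h7 : 3 ≤ ST c ^ 6 := le_trans (by norm_num) (Nat.pow_le_pow_left (two_le_ST c) 6)
      calc 2 * N1 (mOfT c.1) + 3 ≤ 3 * ST c ^ 6 := by omega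
        _ ≤ ST c ^ (6 + 2) := mul_pow_le_pow c (by norm_num)))

/-- **`L₂ = q₁² + ((N₁ + mH) + N₁)` on codes.** [folklore] -/
theorem codeFP_L2 : CodeFP inE natE (fun c => L2 (mOfT c.1) c.2.1) := by
  have h : CodeFP inE natE (fun c => q1 (mOfT c.1) * q1 (mOfT c.1) + ((N1 (mOfT c.1) + mH (mOfT c.1) c.2.1) + N1 (mOfT c.1))) :=
    (natAdd.comp ((natMul.comp (codeFP_q1.pair codeFP_q1)).pair (natAdd.comp ((natAdd.comp (codeFP_N1.pair codeFP_mH)).pair codeFP_N1))) :)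
  exact h.congr fun c => by unfold L2; rfl

/-- `L₂`, unary. [folklore] -/
theorem codeFP_L2_un : CodeFP inE unE (fun c => L2 (mOfT c.1) c.2.1) :=
  ((unOfNatMin.comp (codeFP_BT.pair codeFP_L2)) :).congr fun c => min_eq_left (le_BT c (by norm_num) (L2_le_pow c))

/-- **`q₂ = leastPrimeGe L₂` on codes.** [folklore] -/
theorem codeFP_q2 : CodeFP inE natE (fun c => q2 (mOfT c.1) c.2.1) :=
  ((codeFP_lpgSearch.comp (codeFP_BT.pair codeFP_L2)) :).congr fun c => by
    unfold q2
    exact lpgSearchT_eq (le_BT c (k := 45) (by norm_num) (by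
      have h := L2_le_pow c
      have h3 : 3 ≤ ST c ^ 43 := le_trans (by norm_num) (Nat.pow_le_pow_left (two_le_ST c) 43)
      calc 2 * L2 (mOfT c.1) c.2.1 + 3 ≤ 3 * ST c ^ 43 := by omega
        _ ≤ ST c ^ (43 + 2) := mul_pow_le_pow c (by norm_num)))

/-- **`seedLen = q₂²` on codes.** [folklore] -/
theorem codeFP_seedLen : CodeFP inE natE (fun c => seedLen (mOfT c.1) c.2.1) :=
  ((natMul.comp (codeFP_q2.pair codeFP_q2)) :).congr fun c => by unfold seedLen; rfl

/-! ### The design positions by a bounded-state Horner fold -/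

/-- One step of the fold: `(acc, pw) ↦ ((acc + [bit_c(I)] pw) mod q, pw · k mod q)`, both capped by `q`
(the cap is inactive for `q ≥ 1` and keeps the state bounded on junk `q = 0`). [folklore] -/
def pvStep (B q k I : ℕ) (st : ℕ × ℕ) (c : ℕ) : ℕ × ℕ :=
  (min ((st.1 + if I.testBit (min c B) then st.2 else 0) % q) q, min (st.2 * k % q) q)

/-- **`A_I(k) mod q` by the fold** over `c < min ℓ B` from `(0, 1 mod q)`. [cite: CarmosinoImpagliazzoKabanetsKolokolova2016, §3.1] -/
def polyValFoldT (B q ℓ I k : ℕ) : ℕ := ((List.range (min ℓ B)).foldl (pvStep B q k I) (0, min (1 % q) q)).1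

/-- The design position through the fold. [cite: CarmosinoImpagliazzoKabanetsKolokolova2016, §3.1] -/
def cikkPosCapT (B q ℓ I k : ℕ) : ℕ := polyValFoldT B q ℓ I k + q * k

/-- The fold keeps both state components `≤ q`. [folklore] -/
theorem pvFold_le (B q k I : ℕ) : ∀ (l : List ℕ) (st : ℕ × ℕ), st.1 ≤ q → st.2 ≤ q →
    (l.foldl (pvStep B q k I) st).1 ≤ q ∧ (l.foldl (pvStep B q k I) st).2 ≤ q
  | [], st, h1, h2 => ⟨h1, h2⟩
  | c :: l, st, _, _ => by
    rw [List.foldl_cons]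
    exact pvFold_le B q k I l _ (min_le_right _ _) (min_le_right _ _)

/-- **The fold invariant**: after the first `j ≤ B` exponents the state is
`((Σ_{c<j} [bit_c(I)] k^c) mod q, k^j mod q)` (`q ≥ 1`). [folklore] -/
theorem pvFold_range {B q k I : ℕ} (hq : 1 ≤ q) : ∀ {j : ℕ}, j ≤ B →
    (List.range j).foldl (pvStep B q k I) (0, min (1 % q) q) =
      (((List.range j).map fun c => if I.testBit c then k ^ c else 0).sum % q, k ^ j % q)
  | 0, _ => by simp [min_eq_left (Nat.mod_lt 1 hq).le]
  | j + 1, hj => by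
    rw [List.range_succ, List.foldl_append, pvFold_range hq (by omega), List.foldl_cons, List.foldl_nil, List.map_append,
      List.sum_append, List.map_singleton, List.sum_singleton]
    set S := ((List.range j).map fun c => if I.testBit c then k ^ c else 0).sum
    unfold pvStep
    rw [min_eq_left (show j ≤ B by omega)]
    refine Prod.ext ?_ ?_
    · change min ((S % q + if I.testBit j then k ^ j % q else 0) % q) q = (S + if I.testBit j then k ^ j else 0) % q
      rw [min_eq_left (Nat.mod_lt _ hq).le]
      split_ifs
      · rw [Nat.add_mod_mod, Nat.mod_add_mod]
      · rw [Nat.add_zero, Nat.add_zero, Nat.mod_mod]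
    · change min (k ^ j % q * k % q) q = k ^ (j + 1) % q
      rw [min_eq_left (Nat.mod_lt _ hq).le, pow_succ, Nat.mod_mul_mod]

/-- **The fold computes the design position** (`ℓ ≤ B`, `q ≥ 1`). [folklore] -/
theorem cikkPosCapT_eq {B q ℓ I k : ℕ} (hℓ : ℓ ≤ B) (hq : 1 ≤ q) : cikkPosCapT B q ℓ I k = cikkPosT q ℓ I k := by
  unfold cikkPosCapT polyValFoldT cikkPosT polyValT
  rw [min_eq_left hℓ, pvFold_range hq hℓ]

/-- The code of the design-position arguments `(B, (q, (ℓ, (I, k))))` (`B` unary). [folklore] -/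
abbrev posE : ℕ × (ℕ × (ℕ × (ℕ × ℕ))) → List Bool := pairE unE (pairE natE (pairE natE (pairE natE natE)))

/-- **The design positions on codes.** [cite: CarmosinoImpagliazzoKabanetsKolokolova2016, §3.1] -/
theorem codeFP_cikkPos : CodeFP posE natE (fun p => cikkPosCapT p.1 p.2.1 p.2.2.1 p.2.2.2.1 p.2.2.2.2) := by
  -- context `p : posE`, item `c`, state `(a, b)`
  let tE : (ℕ × (ℕ × (ℕ × (ℕ × ℕ)))) × (ℕ × (ℕ × ℕ)) → List Bool := pairE posE (pairE natE (pairE natE natE))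
  have tB : CodeFP tE unE (fun t => t.1.1) := (fst _ _).fst'
  have tq : CodeFP tE natE (fun t => t.1.2.1) := (fst _ _).snd'.fst'
  have tI : CodeFP tE natE (fun t => t.1.2.2.2.1) := (fst _ _).snd'.snd'.snd'.fst'
  have tk : CodeFP tE natE (fun t => t.1.2.2.2.2) := (fst _ _).snd'.snd'.snd'.snd'
  have tc : CodeFP tE natE (fun t => t.2.1) := (snd _ _).fst'
  have ta : CodeFP tE natE (fun t => t.2.2.1) := (snd _ _).snd'.fst'
  have tb : CodeFP tE natE (fun t => t.2.2.2) := (snd _ _).snd'.snd'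
  have tbit : CodeFP tE bitE (fun t => t.1.2.2.2.1.testBit (min t.2.1 t.1.1)) :=
    (codeFP_testBit.comp (tI.pair (unOfNatMin.comp (tB.pair tc))) :)
  have tadd : CodeFP tE natE (fun t => t.2.2.1 + if t.1.2.2.2.1.testBit (min t.2.1 t.1.1) then t.2.2.2 else 0) :=
    (natAdd.comp (ta.pair (tbit.ite tb (const _ (0 : ℕ)))) :)
  have tfst : CodeFP tE natE (fun t => min ((t.2.2.1 + if t.1.2.2.2.1.testBit (min t.2.1 t.1.1) then t.2.2.2 else 0) % t.1.2.1) t.1.2.1) :=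
    (natMin.comp ((natMod.comp (tadd.pair tq)).pair tq) :)
  have tsnd : CodeFP tE natE (fun t => min (t.2.2.2 * t.1.2.2.2.2 % t.1.2.1) t.1.2.1) :=
    (natMin.comp ((natMod.comp ((natMul.comp (tb.pair tk)).pair tq)).pair tq) :)
  have hstep : CodeFP tE (pairE natE natE) (fun t => pvStep t.1.1 t.1.2.1 t.1.2.2.2.2 t.1.2.2.2.1 t.2.2 t.2.1) :=
    (tfst.pair tsnd).congr fun t => by unfold pvStep; rfl
  have pq : CodeFP posE natE (fun p => p.2.1) := (snd _ _).fst'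
  have hinit : CodeFP posE (pairE natE natE) (fun p => ((0 : ℕ), min (1 % p.2.1) p.2.1)) :=
    ((const _ (0 : ℕ)).pair (natMin.comp ((natMod.comp ((const _ (1 : ℕ)).pair pq)).pair pq)) :)
  have hfold := foldl (eσ := posE) (eα := natE) (eβ := pairE natE natE)
    (step := fun p c st => pvStep p.1 p.2.1 p.2.2.2.2 p.2.2.2.1 st c) (init := fun p => ((0 : ℕ), min (1 % p.2.1) p.2.1))
    hstep hinit (3 * X + 2) (fun p l₁ l₂ => by
      show (pairE natE natE (l₁.foldl (pvStep p.1 p.2.1 p.2.2.2.2 p.2.2.2.1) (0, min (1 % p.2.1) p.2.1))).length ≤ _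
      obtain ⟨h1, h2⟩ := pvFold_le p.1 p.2.1 p.2.2.2.2 p.2.2.2.1 l₁ (0, min (1 % p.2.1) p.2.1) (Nat.zero_le _) (min_le_right _ _)
      have hq : (natE p.2.1).length ≤ (pairE posE (rawE natE) (p, l₁ ++ l₂)).length := by
        simp only [pairE_apply, length_boolPair]; omega
      have ha := (length_natE _).trans_le ((size_mono h1).trans_eq (length_natE _).symm)
      have hb := (length_natE _).trans_le ((size_mono h2).trans_eq (length_natE _).symm)
      simp only [pairE_apply, length_boolPair, eval_add, eval_mul, eval_X, eval_ofNat] at ha hb hq ⊢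
      omega)
  have hR : CodeFP posE (rawE natE) (fun p => List.range (min p.2.2.1 p.1)) :=
    (rangeOf.comp ((fst _ _).pair (snd _ _).snd'.fst') :)
  have hV : CodeFP posE natE (fun p => polyValFoldT p.1 p.2.1 p.2.2.1 p.2.2.2.1 p.2.2.2.2) :=
    ((hfold.comp ((CodeFP.id posE).pair hR)).fst').congr fun p => by unfold polyValFoldT; rfl
  have h : CodeFP posE natE (fun p => polyValFoldT p.1 p.2.1 p.2.2.1 p.2.2.2.1 p.2.2.2.2 + p.2.1 * p.2.2.2.2) :=
    (natAdd.comp (hV.pair (natMul.comp (pq.pair (snd _ _).snd'.snd'.snd'))) :)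
  exact h.congr fun p => by unfold cikkPosCapT; rfl

/-! ### The mild bit as a brick atom -/

/-- **The mildly hard bit on codes**: `(w, (N, (m, r))) ↦ g1T N m r w`, by the brick `coreTF` of part I
(normalised to one symbol). [cite: AroraBarakCC2009, Thm. 19.21] -/
theorem codeFP_g1T : CodeFP (pairE strE (pairE unE (pairE unE strE))) bitE (fun a => g1T a.2.1 a.2.2.1 a.2.2.2 a.1) := by
  refine of_fn (iteFn isNilFn (fun _ => [false]) _root_.id ∘ coreTF)
    (comp_mem_FP (iteFn_mem_FP isNilFn_mem_FP (const_mem_FP _) (PolyTimeComputable.id _)) coreTF_mem_FP) fun a => ?_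
  obtain ⟨w, N, m, r⟩ := a
  have hctx : pairE strE (pairE unE (pairE unE strE)) (w, N, m, r) = boolPair w (tctx N m r) := by
    simp only [pairE_apply, unE_eq_ones, tctx]; rfl
  rw [Function.comp_apply, hctx]
  unfold g1T
  have hlen := length_coreTF_le (boolPair w (tctx N m r))
  rcases hc : coreTF (boolPair w (tctx N m r)) with _ | ⟨b, _ | ⟨b', l⟩⟩
  · rw [iteFn_apply (b := true) (by rfl)]; rfl
  · rw [iteFn_apply (b := false) (by rfl)]; rfl
  · rw [hc] at hlen; simp at hlen

/-! ### The query inputs, the amplified bit, the blocks, the output -/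

/-- **The query inputs on codes**: context `c`, arguments `(I, y)`. [cite: Hirahara2022PartialMCSP, proof of Lemma 8.1] -/
theorem codeFP_inpT : CodeFP (pairE inE (pairE natE (rawE bitE))) (rawE bitE)
    (fun p => inpT (q1 (mOfT p.1.1)) (N1 (mOfT p.1.1)) (mH (mOfT p.1.1) p.1.2.1) p.2.1 p.2.2) := by
  -- outer context `p = (c, (I, y))`, item `rr`; inner context `s = (p, rr)`, item `cc`
  let dE : In × (ℕ × List Bool) → List Bool := pairE inE (pairE natE (rawE bitE))
  let sE : (In × (ℕ × List Bool)) × ℕ → List Bool := pairE dE natE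
  have dB : CodeFP dE unE (fun p => BT p.1) := codeFP_BT.comp (fst _ _)
  have dQ : CodeFP dE natE (fun p => q1 (mOfT p.1.1)) := codeFP_q1.comp (fst _ _)
  have dN1 : CodeFP dE natE (fun p => N1 (mOfT p.1.1)) := codeFP_N1.comp (fst _ _)
  have dMH : CodeFP dE natE (fun p => mH (mOfT p.1.1) p.1.2.1) := codeFP_mH.comp (fst _ _)
  have sB : CodeFP sE unE (fun s => BT s.1.1) := dB.comp (fst _ _)
  have sQ : CodeFP sE natE (fun s => q1 (mOfT s.1.1.1)) := dQ.comp (fst _ _)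
  have sQQ : CodeFP sE natE (fun s => q1 (mOfT s.1.1.1) * q1 (mOfT s.1.1.1)) := (natMul.comp (sQ.pair sQ) :)
  have sN1 : CodeFP sE natE (fun s => N1 (mOfT s.1.1.1)) := dN1.comp (fst _ _)
  have sMH : CodeFP sE natE (fun s => mH (mOfT s.1.1.1) s.1.1.2.1) := dMH.comp (fst _ _)
  have sI : CodeFP sE natE (fun s => s.1.2.1) := (fst _ _).snd'.fst'
  have sY : CodeFP sE (rawE bitE) (fun s => s.1.2.2) := (fst _ _).snd'.snd'
  have sRR : CodeFP sE natE (fun s => s.2) := snd _ _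
  -- the `x`-field bit at the design position
  have sPos : CodeFP sE natE (fun s => cikkPosCapT (BT s.1.1) (q1 (mOfT s.1.1.1)) (mH (mOfT s.1.1.1) s.1.1.2.1) s.1.2.1 s.2) :=
    (codeFP_cikkPos.comp (sB.pair (sQ.pair (sMH.pair (sI.pair sRR)))) :)
  have sX : CodeFP sE bitE (fun s => s.1.2.2.getD (cikkPosCapT (BT s.1.1) (q1 (mOfT s.1.1.1)) (mH (mOfT s.1.1.1) s.1.1.2.1) s.1.2.1 s.2) false) :=
    (getBit.comp (sY.pair sPos) :)
  -- the Hankel parity: inner items `cc`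
  have uI : CodeFP (pairE sE natE) natE (fun u => u.1.1.2.1) := sI.comp (fst _ _)
  have uTb : CodeFP (pairE sE natE) bitE (fun u => u.1.1.2.1.testBit (min u.2 (BT u.1.1.1))) :=
    (codeFP_testBit.comp (uI.pair (unOfNatMin.comp ((sB.comp (fst _ _)).pair (snd _ _)))) :)
  have uPos : CodeFP (pairE sE natE) natE (fun u => q1 (mOfT u.1.1.1.1) * q1 (mOfT u.1.1.1.1) + (u.1.2 + u.2)) :=
    (natAdd.comp ((sQQ.comp (fst _ _)).pair (natAdd.comp ((sRR.comp (fst _ _)).pair (snd _ _)))) :)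
  have uBit : CodeFP (pairE sE natE) bitE (fun u => u.1.1.2.2.getD (q1 (mOfT u.1.1.1.1) * q1 (mOfT u.1.1.1.1) + (u.1.2 + u.2)) false) :=
    (getBit.comp ((sY.comp (fst _ _)).pair uPos) :)
  have sPar : CodeFP sE bitE (fun s => parityT ((List.range (min (mH (mOfT s.1.1.1) s.1.1.2.1) (BT s.1.1))).map fun cc =>
      s.1.2.1.testBit (min cc (BT s.1.1)) && s.1.2.2.getD (q1 (mOfT s.1.1.1) * q1 (mOfT s.1.1.1) + (s.2 + cc)) false)) :=
    (codeFP_parityT.comp ((map (uTb.and uBit)).comp ((CodeFP.id sE).pair (rangeOf.comp (sB.pair sMH)))) :)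
  -- the shift bit
  have sBpos : CodeFP sE natE (fun s => q1 (mOfT s.1.1.1) * q1 (mOfT s.1.1.1) + ((N1 (mOfT s.1.1.1) + mH (mOfT s.1.1.1) s.1.1.2.1) + s.2)) :=
    (natAdd.comp (sQQ.pair (natAdd.comp ((natAdd.comp (sN1.pair sMH)).pair sRR))) :)
  have sBbit : CodeFP sE bitE (fun s => s.1.2.2.getD (q1 (mOfT s.1.1.1) * q1 (mOfT s.1.1.1) + ((N1 (mOfT s.1.1.1) + mH (mOfT s.1.1.1) s.1.1.2.1) + s.2)) false) :=
    (getBit.comp (sY.pair sBpos) :)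
  have sItem := sX.xor (sPar.xor sBbit)
  have h : CodeFP dE (rawE bitE) (fun p => (List.range (min (N1 (mOfT p.1.1)) (BT p.1))).map fun rr =>
      xor (p.2.2.getD (cikkPosCapT (BT p.1) (q1 (mOfT p.1.1)) (mH (mOfT p.1.1) p.1.2.1) p.2.1 rr) false)
        (xor (parityT ((List.range (min (mH (mOfT p.1.1) p.1.2.1) (BT p.1))).map fun cc =>
            p.2.1.testBit (min cc (BT p.1)) && p.2.2.getD (q1 (mOfT p.1.1) * q1 (mOfT p.1.1) + (rr + cc)) false))
          (p.2.2.getD (q1 (mOfT p.1.1) * q1 (mOfT p.1.1) + ((N1 (mOfT p.1.1) + mH (mOfT p.1.1) p.1.2.1) + rr)) false))) :=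
    ((map sItem).comp ((CodeFP.id dE).pair (rangeOf.comp (dB.pair dN1))) :)
  refine h.congr fun p => ?_
  have hN1 : N1 (mOfT p.1.1) ≤ BT p.1 := le_BT p.1 (by norm_num) (N1_le_pow p.1)
  have hMH : mH (mOfT p.1.1) p.1.2.1 ≤ BT p.1 := le_BT p.1 (by norm_num) (mH_le_pow p.1)
  have hq : 1 ≤ q1 (mOfT p.1.1) := (q1_spec (mOfT p.1.1)).2.1.one_lt.le
  unfold inpT
  rw [min_eq_left hN1, min_eq_left hMH]
  refine List.map_congr_left fun rr _ => ?_
  rw [cikkPosCapT_eq hMH hq]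
  congr 2
  congr 1
  refine List.map_congr_left fun cc hcc => ?_
  rw [min_eq_left ((List.mem_range.1 hcc).le.trans hMH)]

/-- **The amplified bit on codes**: context `c`, argument `y`. [cite: Hirahara2022PartialMCSP, proof of Lemma 8.1 (Amp^f)] -/
theorem codeFP_ampT : CodeFP (pairE inE (rawE bitE)) bitE (fun p => ampT (BT p.1) (mOfT p.1.1) p.1.2.1 p.1.1 p.2) := by
  let aE : In × List Bool → List Bool := pairE inE (rawE bitE)
  -- item `I`, context `p = (c, y)`
  have sInp : CodeFP (pairE aE natE) (rawE bitE) (fun s => inpT (q1 (mOfT s.1.1.1)) (N1 (mOfT s.1.1.1)) (mH (mOfT s.1.1.1) s.1.1.2.1) s.2 s.1.2) :=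
    (codeFP_inpT.comp ((fst _ _).fst'.pair ((snd _ _).pair (fst _ _).snd')) :)
  have sW : CodeFP (pairE aE natE) strE (fun s => inpT (q1 (mOfT s.1.1.1)) (N1 (mOfT s.1.1.1)) (mH (mOfT s.1.1.1) s.1.1.2.1) s.2 s.1.2) :=
    bitsToStr.comp sInp
  have sG : CodeFP (pairE aE natE) bitE (fun s => g1T (BT s.1.1) (mOfT s.1.1.1) s.1.1.1
      (inpT (q1 (mOfT s.1.1.1)) (N1 (mOfT s.1.1.1)) (mH (mOfT s.1.1.1) s.1.1.2.1) s.2 s.1.2)) :=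
    (codeFP_g1T.comp (sW.pair ((codeFP_BT.comp (fst _ _).fst').pair ((codeFP_mOfT_un.comp (fst _ _).fst').pair (cR.comp (fst _ _).fst')))) :)
  have h : CodeFP aE bitE (fun p => parityT ((List.range (min (kk (mOfT p.1.1) p.1.2.1) (BT p.1))).map fun I =>
      g1T (BT p.1) (mOfT p.1.1) p.1.1 (inpT (q1 (mOfT p.1.1)) (N1 (mOfT p.1.1)) (mH (mOfT p.1.1) p.1.2.1) I p.2))) :=
    (codeFP_parityT.comp ((map sG).comp ((CodeFP.id aE).pair (rangeOf.comp ((codeFP_BT.comp (fst _ _)).pair (codeFP_kk.comp (fst _ _)))))) :)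
  refine h.congr fun p => ?_
  unfold ampT
  rw [min_eq_left (le_BT p.1 (by norm_num) (kk_le_pow p.1))]

/-- **The NW blocks on codes**: context `c`, argument `J` (the seed is read off `c`). [cite: NisanWigderson1994, §2] -/
theorem codeFP_blockT : CodeFP (pairE inE natE) (rawE bitE)
    (fun p => blockT (q2 (mOfT p.1.1) p.1.2.1) (ell p.1.2.1) (L2 (mOfT p.1.1) p.1.2.1) p.2 p.1.2.2) := by
  let bE : In × ℕ → List Bool := pairE inE natE
  -- item `x`, context `p = (c, J)`
  have sB : CodeFP (pairE bE natE) unE (fun s => BT s.1.1) := codeFP_BT.comp (fst _ _).fst'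
  have sPos : CodeFP (pairE bE natE) natE (fun s => cikkPosCapT (BT s.1.1) (q2 (mOfT s.1.1.1) s.1.1.2.1) (ell s.1.1.2.1) s.1.2 s.2) :=
    (codeFP_cikkPos.comp (sB.pair ((codeFP_q2.comp (fst _ _).fst').pair ((codeFP_ell.comp (fst _ _).fst').pair (((fst _ _).snd').pair (snd _ _))))) :)
  have sBit : CodeFP (pairE bE natE) bitE (fun s => s.1.1.2.2.getD (cikkPosCapT (BT s.1.1) (q2 (mOfT s.1.1.1) s.1.1.2.1) (ell s.1.1.2.1) s.1.2 s.2) false) :=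
    (bitReadNat.comp (sPos.pair (cSl.comp (fst _ _).fst')) :)
  have h : CodeFP bE (rawE bitE) (fun p => (List.range (min (L2 (mOfT p.1.1) p.1.2.1) (BT p.1))).map fun x =>
      p.1.2.2.getD (cikkPosCapT (BT p.1) (q2 (mOfT p.1.1) p.1.2.1) (ell p.1.2.1) p.2 x) false) :=
    ((map sBit).comp ((CodeFP.id bE).pair (rangeOf.comp ((codeFP_BT.comp (fst _ _)).pair (codeFP_L2.comp (fst _ _))))) :)
  refine h.congr fun p => ?_
  have hq : 1 ≤ q2 (mOfT p.1.1) p.1.2.1 := (q2_spec (mOfT p.1.1) p.1.2.1).2.1.one_lt.le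
  have hell : ell p.1.2.1 ≤ BT p.1 := le_BT p.1 (k := 1) (by norm_num) (by rw [pow_one]; exact ell_le_ST p.1)
  unfold blockT
  rw [min_eq_left (le_BT p.1 (by norm_num) (L2_le_pow p.1))]
  refine List.map_congr_left fun x _ => ?_
  rw [cikkPosCapT_eq hell hq]

/-- **The output string on codes** (fuel `BT`). [cite: ImpagliazzoKabanetsWigderson2002, Thm. 11] -/
theorem codeFP_genStrT : CodeFP inE strE (fun c => genStrT (BT c) c.1 c.2.1 c.2.2) := by
  have hcond : CodeFP inE bitE (fun c => decide (seedLen (mOfT c.1) c.2.1 ≤ c.2.2.length)) :=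
    (natLe.comp (codeFP_seedLen.pair (strNatLength.comp cSl)) :)
  have hitem : CodeFP (pairE inE natE) bitE (fun p => ampT (BT p.1) (mOfT p.1.1) p.1.2.1 p.1.1
      (blockT (q2 (mOfT p.1.1) p.1.2.1) (ell p.1.2.1) (L2 (mOfT p.1.1) p.1.2.1) p.2 p.1.2.2)) :=
    (codeFP_ampT.comp ((fst _ _).pair codeFP_blockT) :)
  have hyes : CodeFP inE strE (fun c => (List.range c.2.1).map fun J => ampT (BT c) (mOfT c.1) c.2.1 c.1
      (blockT (q2 (mOfT c.1) c.2.1) (ell c.2.1) (L2 (mOfT c.1) c.2.1) J c.2.2)) :=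
    (bitsToStr.comp ((map hitem).comp ((CodeFP.id inE).pair (urange.comp cNun))) :)
  have hno : CodeFP inE strE (fun c => List.replicate c.2.1 false) :=
    (bitsToStr.comp ((replicateOf bitE).comp ((const inE false).pair cNun)) :)
  refine ((hcond.ite hyes hno).congr fun c => ?_)
  unfold genStrT
  by_cases h : seedLen (mOfT c.1) c.2.1 ≤ c.2.2.length
  · rw [if_pos h, decide_eq_true h, if_pos rfl]
  · rw [if_neg h, decide_eq_false h]; rfl

/-! ### The machine of Theorem 11 -/

/-- The fuel suffices: `2^{N₁(m)} ≤ BT` on the input of `tableGenerator`. [folklore] -/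
theorem two_pow_N1_le_BT {m : ℕ} (f : (Fin m → Bool) → Bool) (n : ℕ) (sl : List Bool) :
    2 ^ N1 m ≤ BT (truthTable f, n, sl) := by
  have h := le_BT (truthTable f, n, sl) (by norm_num) (two_pow_N1_le_pow (truthTable f, n, sl))
  rwa [show mOfT (truthTable f, n, sl).1 = m from mOfT_truthTable f] at h

/-- **IKW Thm. 11, machine half: the generator armed with a truth table is polynomial-time computable.**
There is `F ∈ FP` such that for every `f : {0,1}^m → {0,1}`, output length `n` and seed length `K`,
`tableGenerator F f K n = IKWGen.genPad f n K`: on `⟨tt f, ⟨1ⁿ, s⟩⟩` the machine outputs the `n` bits of the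
explicit generator of `IKWTableGenerator.lean`. [cite: ImpagliazzoKabanetsWigderson2002, Thm. 11 ("there is a polynomial-time computable F")] -/
theorem exists_FP_tableGenerator_eq_genPad :
    ∃ F : List Bool → List Bool, F ∈ FP ∧ ∀ {m : ℕ} (f : (Fin m → Bool) → Bool) (K n : ℕ),
      tableGenerator F f K n = genPad f n K := by
  obtain ⟨F, hF, hFv⟩ := codeFP_genStrT
  refine ⟨F, hF, fun f K n => ?_⟩
  funext s i
  rw [tableGenerator_apply]
  have h := hFv (truthTable f, n, List.ofFn s)
  simp only [pairE_apply] at h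
  change F (boolPair (truthTable f) (boolPair (unaryEncodeNat n) (List.ofFn s))) = _ at h
  rw [h]
  exact genStrT_getD f n K (two_pow_N1_le_BT f n (List.ofFn s)) s i

end IKWGenM

end Literature.Computability.Complexity

end
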